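import Summits.AtomisticToContinuum.Crystallization.Theses.SurfaceTensionNoFoam
import Summits.AtomisticToContinuum.Crystallization.Theorems.PalmUnimodularRigidityBenjaminiSchrammLimit

/-!
# Route `SurfaceTensionNoFoam`, item stmt-AtomisticToContinuum-9230 `BenjaminiSchrammLimit`

The shared item `BenjaminiSchrammLimit` (the Benjamini–Schramm limit of Lennard-Jones ground states,
with point-stationarity, the energy identity and the density-transfer clause) is stated verbatim in
this route's Theses file; it is the theorem
`Summit.AtomisticToContinuum.Crystallization.Theorems.benjaminiSchrammLimit_proof` proved for route
`PalmUnimodularRigidity` (module `…Theorems.PalmUnimodularRigidityBenjaminiSchrammLimit`).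
-/

namespace Summit.AtomisticToContinuum.Crystallization.Theorems

/-- **Item `stmt-AtomisticToContinuum-9230` for route `SurfaceTensionNoFoam`**: the route's
`BenjaminiSchrammLimit` (same statement as in route `PalmUnimodularRigidity`), by
`benjaminiSchrammLimit_proof`. -/
theorem benjaminiSchrammLimit_proof_noFoam :
    Summit.AtomisticToContinuum.Crystallization.Theses.SurfaceTensionNoFoam.BenjaminiSchrammLimit := by
  unfold Summit.AtomisticToContinuum.Crystallization.Theses.SurfaceTensionNoFoam.BenjaminiSchrammLimit
  exact benjaminiSchrammLimit_proof

end Summit.AtomisticToContinuum.Crystallization.Theorems
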